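import Mathlib
import Summits.Ventures.PercRepro2.Defs
import Summits.Ventures.PercRepro2.Graph
import Summits.Ventures.PercRepro2.OneColourSwitch
import Summits.Ventures.PercRepro2.RegionHubSign
import Summits.Ventures.PercRepro2.SideSwitch
import Summits.Ventures.PercRepro2.SideSwitchComps
import Summits.Ventures.PercRepro2.M9NoPocketDefs
import Summits.Ventures.PercRepro2.M9GeneralDHD
import Summits.Ventures.PercRepro2.M9PocketProdAssemblyT
import Summits.Ventures.PercRepro2.M9PocketProdWeightT
import Summits.Ventures.PercRepro2.M9PocketVirtualEdge
import Summits.Ventures.PercRepro2.M9PocketVirtualKonly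
import Summits.Ventures.PercRepro2.M9PocketRSDOutside

/-!
# The five outside sums of the type calculus are non-positive (blind cell PercRepro2, p3 g42,
2026-08-30; `proofs/P3-POCKETRK.md` §10⁶ (b)–(c))

For a non-linking graph `G` (no edge inside `{r, s}`; the neighbourhood of `d` separates `r`
from `s` in `G − d`) and a proposition `δ` (the dead end inside the cluster), the sums over the
OUTSIDE POINTS (`Ω₀`: `Sep`, `p, q` not `Y`-joined to `d`, no vertex other than `r, s, d` in both
the `Y`-world of the three exits and the `W`-world of `{r, s}`, `d ∉ M₂`) of `σ_pq` with the
weights `[δ' ∨ δ]` (`δ'` the outside defect) times a `Y`-link indicator are non-positive: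
`sum_X_nonpos` (points with `d ∈ K₂` of `G`, weight `[δ' ∨ δ]`), `sum_Y_nonpos` (the same
times `[r ~ s]`), `sum_X'_nonpos` (all outside points, weight `[δ' ∨ δ]`), `sum_Zr_nonpos`
(times `[r ~ s ∨ d ~ s]`) and `sum_Zs_nonpos` (times `[r ~ s ∨ r ~ d]`).  The first two are the
defect-weighted `K`-only legal sums of `G` (`sum_konly_weight_nonpos_T'`), the last three those
of the virtual graphs `G + {d, r}`, `G + {d, s}` whose `K`-only legal points are the outside
points (`konly_virt_iff_outside`).  Own work; std axioms.
-/

namespace Summit.Ventures.PercRepro2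

namespace NoPocket

open Finset Classical OneColourSwitch SideSwitch

variable {V : Type*} {E : Type*} {ends : E → Sym2 V} {p q r s d : V}

section Symbols

variable [Fintype V] [DecidableEq V] [Fintype E] [DecidableEq E]

variable (hdr : d ≠ r) (hds : d ≠ s) (hrs : within ends ({r, s} : Set V) = ∅)
  (hsepN : ¬ Conn (endsD ends d) (chi (endsD ends d)
    ({x : V | ∀ e, ends e ≠ s(d, x)} ∪ {r, s})) r s)
  (δ : Prop)

/-- The pointwise identification of an outside summand with a `K`-only summand of weight
`[δ] + [W]·(1 − [δ])` (instances explicit, to unify with the goal's). -/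
lemma ite_konly_eq_p3 {Ω K D W δ : Prop} (i1 : Decidable (Ω ∧ (D ∨ δ))) (i2 : Decidable K)
    (i3 : Decidable δ) (i4 : Decidable W) (hKΩ : K ↔ Ω) (hWD : K → (W ↔ D)) (x y : ℤ)
    (hxy : K → x = y) :
    (@ite ℤ (Ω ∧ (D ∨ δ)) i1 x 0) =
      @ite ℤ K i2 ((@ite ℤ δ i3 1 0 + @ite ℤ W i4 (@ite ℤ δ i3 0 1) 0) * y) 0 := by
  by_cases hK : K
  · have hΩ := hKΩ.1 hK
    have hWD' := hWD hK
    rw [if_pos hK, ← hxy hK]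
    by_cases hD : D
    · rw [if_pos ⟨hΩ, Or.inl hD⟩, if_pos (hWD'.2 hD)]
      by_cases hδ : δ
      · rw [if_pos hδ, if_pos hδ]; ring
      · rw [if_neg hδ, if_neg hδ]; ring
    · rw [if_neg (hWD'.1 · |> hD)]
      by_cases hδ : δ
      · rw [if_pos ⟨hΩ, Or.inr hδ⟩, if_pos hδ]; ring
      · rw [if_neg (fun h => h.2.elim hD hδ), if_neg hδ]; ring
  · rw [if_neg hK, if_neg (fun h => hK (hKΩ.2 h.1))]

/-- The same with the weight `[δ]·z + [W]·(1 − [δ])·z` and the summand `x · z'`,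
`z' = [C]`. -/
lemma ite_konly_eq_link_p3 {Ω K D W δ C : Prop} (i1 : Decidable (Ω ∧ (D ∨ δ))) (i2 : Decidable K)
    (i3 : Decidable δ) (i4 : Decidable W) (i5 : Decidable C) (hKΩ : K ↔ Ω) (hWD : K → (W ↔ D))
    (x y z : ℤ) (hxy : K → x = y) (hz : K → z = @ite ℤ C i5 1 0) :
    (@ite ℤ (Ω ∧ (D ∨ δ)) i1 (x * @ite ℤ C i5 1 0) 0) =
      @ite ℤ K i2 ((@ite ℤ δ i3 z 0 + @ite ℤ W i4 (@ite ℤ δ i3 0 z) 0) * y) 0 := by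
  by_cases hK : K
  · have hΩ := hKΩ.1 hK
    have hWD' := hWD hK
    rw [if_pos hK, ← hxy hK, ← hz hK]
    by_cases hD : D
    · rw [if_pos ⟨hΩ, Or.inl hD⟩, if_pos (hWD'.2 hD)]
      by_cases hδ : δ
      · rw [if_pos hδ, if_pos hδ]; ring
      · rw [if_neg hδ, if_neg hδ]; ring
    · rw [if_neg (hWD'.1 · |> hD)]
      by_cases hδ : δ
      · rw [if_pos ⟨hΩ, Or.inr hδ⟩, if_pos hδ]; ring
      · rw [if_neg (fun h => h.2.elim hD hδ), if_neg hδ]; ring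
  · rw [if_neg hK, if_neg (fun h => hK (hKΩ.2 h.1))]

include hdr hds hrs hsepN in
/-- **`X`: the outside points with `d ∈ K₂` of `G`, weight `[δ' ∨ δ]`.** -/
theorem sum_X_nonpos :
    (∑ ω : Config E, if (sep2 ends p q r s ω ∧ ¬ Conn ends ω p d ∧ ¬ Conn ends ω q d ∧
        (∀ x, x ≠ r → x ≠ s → x ≠ d →
          (Conn ends ω r x ∨ Conn ends ω s x ∨ Conn ends ω d x) → x ∉ M2 ends r s ω) ∧
        d ∉ M2 ends r s ω) ∧ (Conn ends ω r d ∨ Conn ends ω s d) ∧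
        ((Conn ends (OneColourSwitch.compl ω) d p ∨ Conn ends (OneColourSwitch.compl ω) d q ∨
          ∃ x, x ≠ r ∧ x ≠ s ∧ x ≠ d ∧ (Conn ends ω r x ∨ Conn ends ω s x ∨ Conn ends ω d x) ∧
            Conn ends (OneColourSwitch.compl ω) d x) ∨ δ) then
      sigma ends ω p q else 0) ≤ 0 := by
  have key := sum_konly_weight_nonpos_T' (ends := ends) (p := p) (q := q) hdr hds hrs
    (noLinking_of_sepN_T hdr hds hsepN) (fun _ => if δ then 1 else 0)
    (fun _ => if δ then 0 else 1) (fun _ _ => by split_ifs <;> norm_num)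
    (fun _ _ => by split_ifs <;> norm_num)
  refine le_trans (le_of_eq (Finset.sum_congr rfl fun ω _ => ?_)) key
  by_cases hK : d ∈ K2 ends r s ω
  · have hK' : Conn ends ω r d ∨ Conn ends ω s d := mem_K2_iff.1 hK
    simp only [konly_iff_outside hK, WDefect_iff_outside hK]
    split_ifs <;> simp_all
  · have hK' : ¬ (Conn ends ω r d ∨ Conn ends ω s d) := fun h => hK (mem_K2_iff.2 h)
    rw [if_neg (fun h => hK' h.2.1), if_neg (fun h => hK h.2.2.1)]

include hdr hds hrs hsepN in
/-- **`Y`: the outside points with `d ∈ K₂` of `G`, weight `[δ' ∨ δ] · [r ~ s]`.** -/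
theorem sum_Y_nonpos :
    (∑ ω : Config E, if (sep2 ends p q r s ω ∧ ¬ Conn ends ω p d ∧ ¬ Conn ends ω q d ∧
        (∀ x, x ≠ r → x ≠ s → x ≠ d →
          (Conn ends ω r x ∨ Conn ends ω s x ∨ Conn ends ω d x) → x ∉ M2 ends r s ω) ∧
        d ∉ M2 ends r s ω) ∧ (Conn ends ω r d ∨ Conn ends ω s d) ∧
        ((Conn ends (OneColourSwitch.compl ω) d p ∨ Conn ends (OneColourSwitch.compl ω) d q ∨
          ∃ x, x ≠ r ∧ x ≠ s ∧ x ≠ d ∧ (Conn ends ω r x ∨ Conn ends ω s x ∨ Conn ends ω d x) ∧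
            Conn ends (OneColourSwitch.compl ω) d x) ∨ δ) then
      sigma ends ω p q * (if Conn ends ω r s then 1 else 0) else 0) ≤ 0 := by
  have key := sum_konly_weight_nonpos_T' (ends := ends) (p := p) (q := q) hdr hds hrs
    (noLinking_of_sepN_T hdr hds hsepN) (fun σ => if δ then σ else 0)
    (fun σ => if δ then 0 else σ) (fun _ h => by split_ifs <;> linarith)
    (fun _ h => by split_ifs <;> linarith)
  refine le_trans (le_of_eq (Finset.sum_congr rfl fun ω _ => ?_)) key
  by_cases hK : d ∈ K2 ends r s ω
  · have hK' : Conn ends ω r d ∨ Conn ends ω s d := mem_K2_iff.1 hK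
    simp only [konly_iff_outside hK, WDefect_iff_outside hK]
    by_cases hΩ : sep2 ends p q r s ω ∧ ¬ Conn ends ω p d ∧ ¬ Conn ends ω q d ∧
        (∀ x, x ≠ r → x ≠ s → x ≠ d →
          (Conn ends ω r x ∨ Conn ends ω s x ∨ Conn ends ω d x) → x ∉ M2 ends r s ω) ∧
        d ∉ M2 ends r s ω
    · rw [if_pos hΩ, sigma_rs_eq_of_sepN hdr hds hsepN hΩ.2.2.2.2 hΩ.2.2.2.1]
      split_ifs <;> simp_all
    · rw [if_neg (fun h => hΩ h.1), if_neg hΩ]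
  · have hK' : ¬ (Conn ends ω r d ∨ Conn ends ω s d) := fun h => hK (mem_K2_iff.2 h)
    rw [if_neg (fun h => hK' h.2.1), if_neg (fun h => hK h.2.2.1)]

include hdr hds hrs hsepN in
/-- **`X′`: all outside points, weight `[δ' ∨ δ]`** (the virtual graph `G + {d, r}`). -/
theorem sum_X'_nonpos :
    (∑ ω : Config E, if (sep2 ends p q r s ω ∧ ¬ Conn ends ω p d ∧ ¬ Conn ends ω q d ∧
        (∀ x, x ≠ r → x ≠ s → x ≠ d →
          (Conn ends ω r x ∨ Conn ends ω s x ∨ Conn ends ω d x) → x ∉ M2 ends r s ω) ∧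
        d ∉ M2 ends r s ω) ∧
        ((Conn ends (OneColourSwitch.compl ω) d p ∨ Conn ends (OneColourSwitch.compl ω) d q ∨
          ∃ x, x ≠ r ∧ x ≠ s ∧ x ≠ d ∧ (Conn ends ω r x ∨ Conn ends ω s x ∨ Conn ends ω d x) ∧
            Conn ends (OneColourSwitch.compl ω) d x) ∨ δ) then
      sigma ends ω p q else 0) ≤ 0 := by
  have hrs' := within_rs_virt_eq_empty (b := r) hrs
    (by simp only [Set.mem_insert_iff, Set.mem_singleton_iff, not_or]; exact ⟨hdr, hds⟩)
  have hnl := noLinking_of_sepN_T (ends := fun e : Option E => e.elim s(d, r) ends) hdr hds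
    (sepN_virt (b := r) (Or.inl rfl) hsepN)
  have key := sum_konly_weight_nonpos_T' (ends := fun e : Option E => e.elim s(d, r) ends)
    (p := p) (q := q) hdr hds hrs' hnl (fun _ => if δ then 1 else 0)
    (fun _ => if δ then 0 else 1) (fun _ _ => by split_ifs <;> norm_num)
    (fun _ _ => by split_ifs <;> norm_num)
  rw [sum_virt_eq_sum_ext (hg := fun ωp h0 => by
    rw [if_neg]
    rintro ⟨-, -, -, hM⟩
    exact hM (d_mem_M2_virt_of_closed (Or.inl rfl) h0))] at key
  refine le_trans (le_of_eq (Finset.sum_congr rfl fun ω _ => ?_)) key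
  refine ite_konly_eq_p3 _ _ _ _ (konly_virt_iff_outside (Or.inl rfl))
    (fun _ => WDefect_virt_iff (Or.inl rfl)) _ _ (fun hk => ?_)
  have hΩ := (konly_virt_iff_outside (Or.inl rfl)).1 hk
  exact (sigma_pq_virt_eq (Or.inl rfl) hΩ.1 hΩ.2.1).symm

include hdr hds hrs hsepN in
/-- **`Z_r`: all outside points, weight `[δ' ∨ δ] · [r ~ s ∨ d ~ s]`** (the virtual graph `G + {d, r}`). -/
theorem sum_Zr_nonpos :
    (∑ ω : Config E, if (sep2 ends p q r s ω ∧ ¬ Conn ends ω p d ∧ ¬ Conn ends ω q d ∧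
        (∀ x, x ≠ r → x ≠ s → x ≠ d →
          (Conn ends ω r x ∨ Conn ends ω s x ∨ Conn ends ω d x) → x ∉ M2 ends r s ω) ∧
        d ∉ M2 ends r s ω) ∧
        ((Conn ends (OneColourSwitch.compl ω) d p ∨ Conn ends (OneColourSwitch.compl ω) d q ∨
          ∃ x, x ≠ r ∧ x ≠ s ∧ x ≠ d ∧ (Conn ends ω r x ∨ Conn ends ω s x ∨ Conn ends ω d x) ∧
            Conn ends (OneColourSwitch.compl ω) d x) ∨ δ) then
      sigma ends ω p q * (if (Conn ends ω r s ∨ Conn ends ω d s) then 1 else 0) else 0) ≤ 0 := by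
  have hrs' := within_rs_virt_eq_empty (b := r) hrs
    (by simp only [Set.mem_insert_iff, Set.mem_singleton_iff, not_or]; exact ⟨hdr, hds⟩)
  have hnl := noLinking_of_sepN_T (ends := fun e : Option E => e.elim s(d, r) ends) hdr hds
    (sepN_virt (b := r) (Or.inl rfl) hsepN)
  have key := sum_konly_weight_nonpos_T' (ends := fun e : Option E => e.elim s(d, r) ends)
    (p := p) (q := q) hdr hds hrs' hnl (fun σ => if δ then σ else 0)
    (fun σ => if δ then 0 else σ) (fun _ h => by split_ifs <;> linarith)
    (fun _ h => by split_ifs <;> linarith)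
  rw [sum_virt_eq_sum_ext (hg := fun ωp h0 => by
    rw [if_neg]
    rintro ⟨-, -, -, hM⟩
    exact hM (d_mem_M2_virt_of_closed (Or.inl rfl) h0))] at key
  refine le_trans (le_of_eq (Finset.sum_congr rfl fun ω _ => ?_)) key
  refine ite_konly_eq_link_p3 _ _ _ _ _ (konly_virt_iff_outside (Or.inl rfl))
    (fun _ => WDefect_virt_iff (Or.inl rfl)) _ _ _ (fun hk => ?_) (fun hk => ?_)
  · have hΩ := (konly_virt_iff_outside (Or.inl rfl)).1 hk
    exact (sigma_pq_virt_eq (Or.inl rfl) hΩ.1 hΩ.2.1).symm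
  · have hΩ := (konly_virt_iff_outside (Or.inl rfl)).1 hk
    rw [sigma_rs_virt_eq_of_not_compl
      (not_conn_compl_rs_of_sepN hdr hds hsepN hΩ.2.2.2.2 hΩ.2.2.2.1)]
    by_cases h : Conn ends ω r s ∨ Conn ends ω d s
    · rw [if_pos (join_r_iff.2 h), if_pos h]
    · rw [if_neg (fun h' => h (join_r_iff.1 h')), if_neg h]

include hdr hds hrs hsepN in
/-- **`Z_s`: all outside points, weight `[δ' ∨ δ] · [r ~ s ∨ r ~ d]`** (the virtual graph `G + {d, s}`). -/
theorem sum_Zs_nonpos :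
    (∑ ω : Config E, if (sep2 ends p q r s ω ∧ ¬ Conn ends ω p d ∧ ¬ Conn ends ω q d ∧
        (∀ x, x ≠ r → x ≠ s → x ≠ d →
          (Conn ends ω r x ∨ Conn ends ω s x ∨ Conn ends ω d x) → x ∉ M2 ends r s ω) ∧
        d ∉ M2 ends r s ω) ∧
        ((Conn ends (OneColourSwitch.compl ω) d p ∨ Conn ends (OneColourSwitch.compl ω) d q ∨
          ∃ x, x ≠ r ∧ x ≠ s ∧ x ≠ d ∧ (Conn ends ω r x ∨ Conn ends ω s x ∨ Conn ends ω d x) ∧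
            Conn ends (OneColourSwitch.compl ω) d x) ∨ δ) then
      sigma ends ω p q * (if (Conn ends ω r s ∨ Conn ends ω r d) then 1 else 0) else 0) ≤ 0 := by
  have hrs' := within_rs_virt_eq_empty (b := s) hrs
    (by simp only [Set.mem_insert_iff, Set.mem_singleton_iff, not_or]; exact ⟨hdr, hds⟩)
  have hnl := noLinking_of_sepN_T (ends := fun e : Option E => e.elim s(d, s) ends) hdr hds
    (sepN_virt (b := s) (Or.inr rfl) hsepN)
  have key := sum_konly_weight_nonpos_T' (ends := fun e : Option E => e.elim s(d, s) ends)
    (p := p) (q := q) hdr hds hrs' hnl (fun σ => if δ then σ else 0)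
    (fun σ => if δ then 0 else σ) (fun _ h => by split_ifs <;> linarith)
    (fun _ h => by split_ifs <;> linarith)
  rw [sum_virt_eq_sum_ext (hg := fun ωp h0 => by
    rw [if_neg]
    rintro ⟨-, -, -, hM⟩
    exact hM (d_mem_M2_virt_of_closed (Or.inr rfl) h0))] at key
  refine le_trans (le_of_eq (Finset.sum_congr rfl fun ω _ => ?_)) key
  refine ite_konly_eq_link_p3 _ _ _ _ _ (konly_virt_iff_outside (Or.inr rfl))
    (fun _ => WDefect_virt_iff (Or.inr rfl)) _ _ _ (fun hk => ?_) (fun hk => ?_)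
  · have hΩ := (konly_virt_iff_outside (Or.inr rfl)).1 hk
    exact (sigma_pq_virt_eq (Or.inr rfl) hΩ.1 hΩ.2.1).symm
  · have hΩ := (konly_virt_iff_outside (Or.inr rfl)).1 hk
    rw [sigma_rs_virt_eq_of_not_compl
      (not_conn_compl_rs_of_sepN hdr hds hsepN hΩ.2.2.2.2 hΩ.2.2.2.1)]
    by_cases h : Conn ends ω r s ∨ Conn ends ω r d
    · rw [if_pos (join_s_iff.2 h), if_pos h]
    · rw [if_neg (fun h' => h (join_s_iff.1 h')), if_neg h]

end Symbols

end NoPocket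

end Summit.Ventures.PercRepro2
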